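/-
COR-CM (cell pub-hodgecm2, stage 2 of the Hodge ladder) — count-neutral own lane DEG12-MARKMAN-INPUT (seat
prover-pub-hodgecm2-b07-g56-0, binder prover b07, gen 56; HOME/INBOX.md CLAIM 2026-08-21T20:4xZ, rule (1) single claimant;
HOME/pub-hodgecm2-b07/ORBIT-COUNT.md v2 §7).  Theorems only: no definition, no named fact, no `sorry`; nothing of seats b09/b23/b30
or of the model layer is restated; `Interfaces.lean` (C1), every E term, `B01/*`, `Transposition/*` untouched.
HONEST FRAMING (COORDINATOR RULING — HODGE FRAMING CORRECTION, 2026-08-21T11:55:35Z): `HC_CM` is NOT proved, here or anywhere in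
the tree.  Everything below is CONDITIONAL on the displayed named fact `HodgeTheory.Markman2025_weilClasses_algebraic_abelianFourfold`
(E. Markman, UNREFEREED) — and, in §2, on Shimura's type-inflation binder `Shimura1998_Thm3_isogenousPower`, which §3 discharges by the
tree theorem `thm3_isogenousPower_of_riemann deligneMilne1982_Thm_6_20_full_holds cmAbelianVarietyRealised_holds`.
T5 (coordinator ruling 15:33:56Z (3)): binder set of the closed §3 theorems = {Markman's fourfold named fact} ∪ data descriptions
(`h6`, `h2`, `i`, `i'`, `j`, `Ψ`, `Φ`, `hprim` — inhabited: any sextic CM field containing an imaginary quadratic field and any of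
its primitive CM types); §2 adds `Shimura1998_Thm3_isogenousPower`, a tree theorem modulo the two `_holds` facts of record; no
contradiction derivable; checker: self, 2026-08-21.
-/
import Summits.HodgeConjecture.CorCM.SexticCMThreefoldCurvePowersHodgeOfMarkman
import Summits.HodgeConjecture.CorCM.AndreRiemannBiproducts
import Literature.AlgebraicGeometry.ComplexMultiplication.ShimuraIsogenousPowerOfRiemann
import Literature.AlgebraicGeometry.HodgeTheory.AbelianVarietyHodgeFullnessHolds
import HarnessLib

/-!
# The Markman FOURFOLD column at any degree: `HC(A_{(M,Ψ^M)} × A_{(M,Φ^M)})` for types induced from an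
# imaginary quadratic field and from a sextic CM subfield, modulo Markman

For a CM field `M` of ANY degree, a sextic CM field `L` with `j : L → M`, an imaginary quadratic field `k` with `i : k → L`
and `i' : k → M`, a CM type `Ψ` of `k` and a CM type `Φ` of `L` that is NOT induced from `k` along `i` (e.g. `Φ` primitive),
every product `A₁ × A₂` of a realisation `A₁ ⊨ (M; Ψ^M)` of the type induced from `k` and a realisation `A₂ ⊨ (M; Φ^M)` of
the type induced from `L` satisfies the Hodge conjecture in every codimension, GIVEN ONLY
`Markman2025_weilClasses_algebraic_abelianFourfold` (§2 modulo Shimura's `Shimura1998_Thm3_isogenousPower`, §3 closed on the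
tree theorems; §3 also reads it on the record's product `Domination.cmProdAV M cmAbelianVarietyRealised_holds 1 ![Ψ^M, Φ^M]`).

PROOF.  By Shimura's type inflation (`Shimura1998_Thm3_isogenousPower`, a tree theorem from Riemann's theorem:
`ComplexMultiplication.thm3_isogenousPower_of_riemann`) `A₁` is isogenous to a power `E^{m₁}` of a realisation `E ⊨ (k; Ψ)` (a
CM elliptic curve) and `A₂` to a power `B^{m₂}` of a realisation `B ⊨ (L; Φ)` (a CM threefold); §1 reads this as a DOMINATION by
a biproduct of copies.  Hence `A₁ × A₂` is dominated by `⨁_l ![E, B] (κ l)` over `Fin (m₁ + m₂)` (the biproduct calculus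
`AndreRiemann.avDominatedBy_prod_of_biproduct` / `avDominatedBy_biproduct_reindex` of `CorCM/AndreRiemannBiproducts.lean`), and
seat b30's `SexticCMThreefold.hodgeConjectureFor_biproduct_comp_vec_of_not_induced_of_markman` (`CorCM/SexticCMThreefoldCurvePowersHodgeOfMarkman.lean`:
the Hodge conjecture for every `⨁_l ![E, B] (κ l)`, `B ⊨ (L; Φ)` with `Φ` not induced from `k`, modulo Markman's fourfold theorem)
descends along the domination (`Domination.hodgeConjectureFor_of_avDominatedBy`).

USE (HOME/pub-hodgecm2-b07/ORBIT-COUNT.md v2 §7).  These products are the «known products» of the MARKMAN COLUMN of the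
degree-12 census: in the exponent-vector model of `Census/FaceSquaresModel.lean` the classes granted by Markman's fourfold
theorem on the `D₆`- and `ℤ/6×ℤ/2`-slices are exactly the Weil classes of the fourfolds `E_a × T_j` (a `k_a`-curve times a
threefold with CM by a sextic CM subfield `K_j ⊃ k_a`), i.e. Hodge weights on `A_{(M,Ψ_a^M)} × A_{(M,Φ_j^M)}`; fed to seat b23's
enlarged face transport `hodgeConjectureFor_of_avDominatedBy_isProductOf_of_exists_facePeriod_of_hodgeConjectureFor_on`
(`CorCM/FacePeriodsKnownProducts.lean`) through its `hHC` binder — the shape of §3's second theorem — they reduce the number of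
face periods a `D₆` closure consumes from `8` to `4` and a `ℤ/6×ℤ/2` closure from `6` to `5` (seat b07's exact computation,
`HOME/pub-hodgecm2-b07/orbit-count/markman_column.py`; lower bounds = seat b17's kernel theorems `four_le_card_of_generates`,
`five_le_card_of_generates`).  The census-transport file that consumes this one is NOT written here.

References: [cite: Markman2025SurveySecant, Thm. 1.2]; [cite: Shimura1998, §6.2 Theorem 3 and §8.4]; [cite: MumfordAV1970, §19
Thm. 1 and p. 169]; [cite: DeligneMilne1982Tannakian, §6 Thm. 6.20 (Riemann), p. 212]; [cite: Andre1992HodgeCM, Théorème].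
-/

noncomputable section

open CategoryTheory CategoryTheory.Limits NumberField
open Literature.AlgebraicGeometry Literature.AlgebraicGeometry.Motives Literature.AlgebraicGeometry.HodgeTheory
open Literature.AlgebraicGeometry.ComplexMultiplication (IsCMTypeRealisation Shimura1998_Thm3_isogenousPower
  thm3_isogenousPower_of_riemann)
open Literature.NumberTheory.ComplexMultiplication (inducedCMType)
open Literature.NumberTheory.Automorphic.PicardCM (cmRealisation CMAbelianVarietyRealised)
open Summit.HodgeConjecture.CorCM.Domination
open Summit.HodgeConjecture.CorCM.AndreRiemann (sumFam avDominatedBy_prod_of_biproduct avDominatedBy_biproduct_reindex)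

namespace Summit.HodgeConjecture.CorCM.InducedCurveThreefold

/-! ## §1 Shimura's type inflation, read as a domination by a biproduct of copies -/

/-- **A realisation of an induced type is dominated by a biproduct of copies of a realisation of the base type.**  If
`(A′, ι′, θ′)` realises `(M; Φ^M)` for `j : L → M`, then there is a realisation `B ⊨ (L; Φ)` and an `h` with `A′` dominated by
`⨁_{l < h} B` (Shimura's Theorem 3: an isogeny `A′ → P` onto a limit fan `P` of `h` copies of `B`; `P ≅ ⨁ B` by uniqueness of
limits). [cite: Shimura1998, §6.2 Theorem 3 (pp. 41–43)] [cite: MumfordAV1970, §19] -/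
theorem exists_avDominatedBy_biproduct_of_inducedCMType (hd : Shimura1998_Thm3_isogenousPower)
    {L M : Type} [Field L] [NumberField L] [IsCMField L] [Field M] [NumberField M] [IsCMField M]
    (j : L →+* M) (Φ : CMType L)
    {A' : AbelianVariety ℂ} {ι' : 𝓞 M →+* End A'} {θ' : M →+* Module.End ℂ (complexBetti A'.X 1)}
    (hA' : IsCMTypeRealisation (inducedCMType j Φ) A' ι' θ') :
    ∃ (B : AbelianVariety ℂ) (ιB : 𝓞 L →+* End B) (θB : L →+* Module.End ℂ (complexBetti B.X 1)),
      IsCMTypeRealisation Φ B ιB θB ∧ ∃ h : ℕ, AVDominatedBy A' (⨁ fun _ : Fin h => B) := by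
  classical
  obtain ⟨B, ιB, θB, hB, h, P, π, ⟨hlim⟩, g, hg, -⟩ := hd L M j Φ A' ι' θ' hA'
  let eP : P ≅ ⨁ (fun _ : Fin h => B) := hlim.conePointUniqueUpToIso (biproduct.isLimit (fun _ : Fin h => B))
  exact ⟨B, ιB, θB, hB, h, (AVDominatedBy.of_isIsogeny_hom hg (AVDominatedBy.refl P)).of_iso_right eP⟩

/-- **Two induced realisations: the product is dominated by a two-slot biproduct `⨁_l ![E, B] (κ l)`.**  With `A₁ ⊨ (M; Ψ^M)`
(`Ψ` a type of `k`, `i' : k → M`) and `A₂ ⊨ (M; Φ^M)` (`Φ` a type of `L`, `j : L → M`) there are realisations `E ⊨ (k; Ψ)`,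
`B ⊨ (L; Φ)`, an `N` and a slot map `κ : Fin N → Fin 2` with `A₁ × A₂` dominated by `⨁_l ![E, B] (κ l)` (§1 twice, then
`AndreRiemann.avDominatedBy_prod_of_biproduct` and the reindexing `Fin (m₁ + m₂) ≃ Fin m₁ ⊕ Fin m₂`).
[cite: Shimura1998, §6.2 Theorem 3] [cite: MumfordAV1970, §19] -/
theorem exists_avDominatedBy_biproduct_vec_of_inducedCMType_pair (hd : Shimura1998_Thm3_isogenousPower)
    {M : Type} [Field M] [NumberField M] [IsCMField M]
    {L : Type} [Field L] [NumberField L] [IsCMField L] (j : L →+* M)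
    {k : Type} [Field k] [NumberField k] [IsCMField k] (i' : k →+* M) (Ψ : CMType k) (Φ : CMType L)
    {A₁ : AbelianVariety ℂ} {ι₁ : 𝓞 M →+* End A₁} {θ₁ : M →+* Module.End ℂ (complexBetti A₁.X 1)}
    (hA₁ : IsCMTypeRealisation (inducedCMType i' Ψ) A₁ ι₁ θ₁)
    {A₂ : AbelianVariety ℂ} {ι₂ : 𝓞 M →+* End A₂} {θ₂ : M →+* Module.End ℂ (complexBetti A₂.X 1)}
    (hA₂ : IsCMTypeRealisation (inducedCMType j Φ) A₂ ι₂ θ₂) :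
    ∃ (E : AbelianVariety ℂ) (ιE : 𝓞 k →+* End E) (θE : k →+* Module.End ℂ (complexBetti E.X 1))
      (B : AbelianVariety ℂ) (ιB : 𝓞 L →+* End B) (θB : L →+* Module.End ℂ (complexBetti B.X 1)),
      IsCMTypeRealisation Ψ E ιE θE ∧ IsCMTypeRealisation Φ B ιB θB ∧
      ∃ (N : ℕ) (κ : Fin N → Fin 2),
        AVDominatedBy (A₁.prod A₂) (⨁ fun l => (![E, B] : Fin 2 → AbelianVariety ℂ) (κ l)) := by
  classical
  obtain ⟨E, ιE, θE, hE, m₁, hd₁⟩ := exists_avDominatedBy_biproduct_of_inducedCMType hd i' Ψ hA₁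
  obtain ⟨B, ιB, θB, hB, m₂, hd₂⟩ := exists_avDominatedBy_biproduct_of_inducedCMType hd j Φ hA₂
  refine ⟨E, ιE, θE, B, ιB, θB, hE, hB, m₁ + m₂,
    fun l => Sum.elim (fun _ => (0 : Fin 2)) (fun _ => 1) (finSumFinEquiv.symm l), ?_⟩
  -- `A₁ × A₂` is dominated by `⨁ sumFam`, reindexed over `Fin (m₁ + m₂)`
  have hdom : AVDominatedBy (A₁.prod A₂)
      (⨁ (sumFam (fun _ : Fin m₁ => E) (fun _ : Fin m₂ => B) ∘ ⇑finSumFinEquiv.symm)) :=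
    avDominatedBy_biproduct_reindex finSumFinEquiv.symm (avDominatedBy_prod_of_biproduct hd₁ hd₂)
  -- the summands are `![E, B] (κ l)`
  have hsum : ∀ x : Fin m₁ ⊕ Fin m₂, sumFam (fun _ : Fin m₁ => E) (fun _ : Fin m₂ => B) x =
      (![E, B] : Fin 2 → AbelianVariety ℂ) (Sum.elim (fun _ => (0 : Fin 2)) (fun _ => 1) x) := by
    rintro (a | b) <;> rfl
  exact hdom.of_iso_right (biproduct.mapIso fun l => eqToIso (hsum (finSumFinEquiv.symm l)))

/-! ## §2 The Hodge conjecture for `A₁ × A₂`, modulo Markman's fourfold theorem and Shimura's inflation binder -/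

/-- **`HC(A₁ × A₂)` for realisations of the two induced types, modulo Markman and Shimura's Theorem 3.**  `M` a CM field
(any degree), `L` a sextic CM field with `j : L → M`, `k` imaginary quadratic with `i : k → L`, `i' : k → M`, `Ψ` a CM type of
`k`, `Φ` a CM type of `L` NOT induced from `k` along `i`; `A₁ ⊨ (M; Ψ^M)` along `i'`, `A₂ ⊨ (M; Φ^M)` along `j`.  Then every
rational Hodge class on `A₁ × A₂` is algebraic, in every codimension, GIVEN `Markman2025_weilClasses_algebraic_abelianFourfold`
and `Shimura1998_Thm3_isogenousPower` (§1 + seat b30's `SexticCMThreefold.hodgeConjectureFor_biproduct_comp_vec_of_not_induced_of_markman`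
+ `Domination.hodgeConjectureFor_of_avDominatedBy`).  (FRAMING: conditional; `HC_CM` is not proved.)
[cite: Markman2025SurveySecant, Thm. 1.2] [cite: Shimura1998, §6.2 Theorem 3 and §8.4] [cite: MumfordAV1970, §19 Thm. 1 and p. 169] -/
theorem hodgeConjectureFor_prod_of_inducedCMType_pair_of_markman_of_shimura
    (hW4 : Markman2025_weilClasses_algebraic_abelianFourfold) (hd : Shimura1998_Thm3_isogenousPower)
    {M : Type} [Field M] [NumberField M] [IsCMField M]
    {L : Type} [Field L] [NumberField L] [IsCMField L] (h6 : Module.finrank ℚ L = 6) (j : L →+* M)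
    {k : Type} [Field k] [NumberField k] [IsCMField k] (h2 : Module.finrank ℚ k = 2) (i : k →+* L) (i' : k →+* M)
    (Ψ : CMType k) {Φ : CMType L} (hprim : ∃ s ∈ Φ.1, ∃ s' ∈ Φ.1, s.comp i ≠ s'.comp i)
    {A₁ : AbelianVariety ℂ} {ι₁ : 𝓞 M →+* End A₁} {θ₁ : M →+* Module.End ℂ (complexBetti A₁.X 1)}
    (hA₁ : IsCMTypeRealisation (inducedCMType i' Ψ) A₁ ι₁ θ₁)
    {A₂ : AbelianVariety ℂ} {ι₂ : 𝓞 M →+* End A₂} {θ₂ : M →+* Module.End ℂ (complexBetti A₂.X 1)}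
    (hA₂ : IsCMTypeRealisation (inducedCMType j Φ) A₂ ι₂ θ₂) :
    HodgeConjectureFor (A₁.prod A₂).dim (A₁.prod A₂).X := by
  obtain ⟨E, ιE, θE, B, ιB, θB, hE, hB, N, κ, hdom⟩ :=
    exists_avDominatedBy_biproduct_vec_of_inducedCMType_pair hd j i' Ψ Φ hA₁ hA₂
  exact hodgeConjectureFor_of_avDominatedBy
    (SexticCMThreefold.hodgeConjectureFor_biproduct_comp_vec_of_not_induced_of_markman hW4 h6 h2 i hE hB hprim κ) hdom

/-! ## §3 CLOSED on the tree theorems (Riemann's theorem and the realisation record OF RECORD) -/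

/-- **`HC(A₁ × A₂)` for realisations of the two induced types, GIVEN ONLY Markman's fourfold theorem** (Shimura's Theorem 3
supplied by `thm3_isogenousPower_of_riemann deligneMilne1982_Thm_6_20_full_holds cmAbelianVarietyRealised_holds`).
(FRAMING: conditional on that unrefereed theorem; `HC_CM` is not proved.)
[cite: Markman2025SurveySecant, Thm. 1.2] [cite: Shimura1998, §6.2 Theorem 3 and §8.4]
[cite: DeligneMilne1982Tannakian, §6 Thm. 6.20 (Riemann), p. 212] [cite: MumfordAV1970, §19 Thm. 1 and p. 169] -/
theorem hodgeConjectureFor_prod_of_inducedCMType_pair_of_markman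
    (hW4 : Markman2025_weilClasses_algebraic_abelianFourfold)
    {M : Type} [Field M] [NumberField M] [IsCMField M]
    {L : Type} [Field L] [NumberField L] [IsCMField L] (h6 : Module.finrank ℚ L = 6) (j : L →+* M)
    {k : Type} [Field k] [NumberField k] [IsCMField k] (h2 : Module.finrank ℚ k = 2) (i : k →+* L) (i' : k →+* M)
    (Ψ : CMType k) {Φ : CMType L} (hprim : ∃ s ∈ Φ.1, ∃ s' ∈ Φ.1, s.comp i ≠ s'.comp i)
    {A₁ : AbelianVariety ℂ} {ι₁ : 𝓞 M →+* End A₁} {θ₁ : M →+* Module.End ℂ (complexBetti A₁.X 1)}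
    (hA₁ : IsCMTypeRealisation (inducedCMType i' Ψ) A₁ ι₁ θ₁)
    {A₂ : AbelianVariety ℂ} {ι₂ : 𝓞 M →+* End A₂} {θ₂ : M →+* Module.End ℂ (complexBetti A₂.X 1)}
    (hA₂ : IsCMTypeRealisation (inducedCMType j Φ) A₂ ι₂ θ₂) :
    HodgeConjectureFor (A₁.prod A₂).dim (A₁.prod A₂).X :=
  hodgeConjectureFor_prod_of_inducedCMType_pair_of_markman_of_shimura hW4
    (thm3_isogenousPower_of_riemann deligneMilne1982_Thm_6_20_full_holds cmAbelianVarietyRealised_holds)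
    h6 j h2 i i' Ψ hprim hA₁ hA₂

/-- **The Markman fourfold column, record form — the `hHC` binder of the enlarged face transport.**  For a CM field `M`, a sextic
CM field `L` with `j : L → M`, an imaginary quadratic `k` with `i : k → L`, `i' : k → M`, a CM type `Ψ` of `k` and a CM type `Φ`
of `L` not induced from `k`: the record's product `Domination.cmProdAV M cmAbelianVarietyRealised_holds 1 ![Ψ^M, Φ^M] =
A_{(M,Ψ^M)} × A_{(M,Φ^M)}` (the CHOSEN realisations, read over `M` by `Domination.isCMTypeRealisation_cmCode`) satisfies the Hodge
conjecture in every codimension, GIVEN ONLY `Markman2025_weilClasses_algebraic_abelianFourfold`.  (FRAMING: conditional; `HC_CM` is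
not proved; no period is produced.) [cite: Markman2025SurveySecant, Thm. 1.2] [cite: Shimura1998, §6.2 Theorem 3 and §8.4]
[cite: DeligneMilne1982Tannakian, §6 Thm. 6.20 (Riemann), p. 212] [cite: MumfordAV1970, §19 Thm. 1 and p. 169] -/
theorem hodgeConjectureFor_cmProdAV_inducedCMType_pair_of_markman
    (hW4 : Markman2025_weilClasses_algebraic_abelianFourfold)
    {M : Type} [Field M] [NumberField M] [IsCMField M]
    {L : Type} [Field L] [NumberField L] [IsCMField L] (h6 : Module.finrank ℚ L = 6) (j : L →+* M)
    {k : Type} [Field k] [NumberField k] [IsCMField k] (h2 : Module.finrank ℚ k = 2) (i : k →+* L) (i' : k →+* M)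
    (Ψ : CMType k) {Φ : CMType L} (hprim : ∃ s ∈ Φ.1, ∃ s' ∈ Φ.1, s.comp i ≠ s'.comp i) :
    HodgeConjectureFor (cmProdAV M cmAbelianVarietyRealised_holds 1 ![inducedCMType i' Ψ, inducedCMType j Φ]).dim
      (cmProdAV M cmAbelianVarietyRealised_holds 1 ![inducedCMType i' Ψ, inducedCMType j Φ]).X :=
  hodgeConjectureFor_prod_of_inducedCMType_pair_of_markman hW4 h6 j h2 i i' Ψ hprim
    (isCMTypeRealisation_cmCode M cmAbelianVarietyRealised_holds (inducedCMType i' Ψ))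
    (isCMTypeRealisation_cmCode M cmAbelianVarietyRealised_holds (inducedCMType j Φ))

end Summit.HodgeConjecture.CorCM.InducedCurveThreefold

end
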